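import Literature.Computability.MetaComplexity.CuttingPlanesInterpolation
import Literature.Computability.MetaComplexity.CliqueColouringResolutionLowerBound
import HarnessLib

/-!
# Exponential lower bound for cutting planes with small coefficients on the clique–colouring formulas

Bonet–Pitassi–Raz's theorem (1997, §4; Krajíček 1997, §7; the small-coefficient case of Pudlák 1997,
Thm. 3): cutting planes refutations of the clique–colouring CNF
`Clique_{m,k}(x,q) ∧ Colour_{m,k-1}(x,r)`, `k = ⌊√m⌋` (`CliqueColouring.cliqueColourCNF`,
`CliqueColouringFormulas.lean`), whose lines have polynomially bounded coefficients are
exponentially long: for all large `m`,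

  `2^{m^{1/8}} ≤ 8 |π| (cpNorm π + 3)³`

for EVERY `CP` refutation `π` (`cliqueColour_cuttingPlanes_lowerBound`), where `cpNorm π` is the
largest `ℓ¹`-norm `|b| + ∑ |aᵥ|` of a line of `π` (`CuttingPlanes.lean`).  In particular a
refutation of norm `≤ m^c` has at least `2^{m^{1/8}} / (8 (m^c + 3)³)` lines.

Proof: feasible monotone interpolation for cutting planes (`cp_monotone_interpolation'`,
`CuttingPlanesInterpolation.lean`: the clique part has only positive edge literals, the colouring
part only negative ones) gives a monotone `{∧₂, ∨₂}`-circuit with `≤ 8 |π| (cpNorm π + 3)³` gates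
accepting the clique vectors of all `k`-sets and rejecting the colouring vectors of all
`(k-1)`-colourings; the tree's proved Razborov–Alon–Boppana bound `cliqueSqrt_monotone_lowerBound`
bounds its size below by `2^{m^{1/8}}`.

## References

* M. Bonet, T. Pitassi, R. Raz, J. Symbolic Logic 62 (1997), §4 [BonetPitassiRaz1997].
* P. Pudlák, J. Symbolic Logic 62 (1997), Thm. 3 and §7 [Pudlak1997].
* J. Krajíček, J. Symbolic Logic 62 (1997), §7 [Krajicek1997].
-/

namespace Literature.Computability.MetaComplexity

open Finset Filter Literature.Computability.Complexity CliqueColouring CPSplit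

/-- The clique part has only positive edge literals and `q`-literals: admissible as `A`.
[cite: BonetPitassiRaz1997, §4] -/
theorem okA_of_mem_cliqueCNF {m k c : ℕ} : ∀ C ∈ cliqueCNF m k c, ∀ l ∈ C, okA l = true := by
  intro C hC l hl
  rcases literal_cliqueCNF hC hl with ⟨e, rfl⟩ | ⟨i, v, b, rfl⟩
  · rfl
  · rfl

/-- The colouring part has only NEGATIVE edge literals and `r`-literals: admissible as `B` in the
monotone case. [cite: BonetPitassiRaz1997, §4] -/
theorem okB_of_mem_colourCNF {m k c : ℕ} : ∀ C ∈ colourCNF m k c, ∀ l ∈ C, okB l = true := by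
  intro C hC l hl
  simp only [colourCNF, List.mem_append] at hC
  rcases hC with hC | hC
  · obtain ⟨v, rfl⟩ := mem_colourPos hC
    simp only [List.mem_map, List.mem_finRange, true_and] at hl
    obtain ⟨a, rfl⟩ := hl
    rfl
  · obtain ⟨u, v, a, huv, rfl⟩ := mem_colourEdge hC
    simp only [List.mem_cons, List.not_mem_nil, or_false] at hl
    rcases hl with rfl | rfl | rfl
    · rfl
    · rfl
    · rfl

/-- **Monotone interpolants of clique–colouring `CP` refutations** (Bonet–Pitassi–Raz 1997, §4):
for `2 ≤ k ≤ m`, a cutting planes refutation `π` of `Clique_{m,k} ∧ Colour_{m,k-1}` yields a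
monotone circuit over `{∧₂, ∨₂}` with at most `8 |π| (cpNorm π + 3)³` gates that accepts the
clique vector of every `k`-set and rejects the colouring vector of every `(k-1)`-colouring.
[cite: BonetPitassiRaz1997, §4] [cite: Pudlak1997, Thm. 3] -/
theorem exists_monotone_circuit_of_cliqueColour_cpRefutation {m k : ℕ} (hk : 2 ≤ k) (hkm : k ≤ m)
    {π : List (CPStep (CliqueColouring.Var m k (k - 1)))}
    (hπ : IsCPRefutation (cliqueColourCNF m k (k - 1)) π) :
    ∃ f : ((⊤ : SimpleGraph (Fin m)).edgeSet → Bool) → Bool,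
      (∀ S : Finset (Fin m), #S = k → f (cliqueVec S) = true) ∧
      (∀ O : Fin m → Fin (k - 1), f (colorVec O) = false) ∧
      ∃ C : Circuit (⊤ : SimpleGraph (Fin m)).edgeSet,
        C.IsOver monotoneBasis ∧ C.size ≤ 8 * π.length * (cpNorm π + 3) ^ 3 ∧ C.Computes f := by
  classical
  obtain ⟨Z₀, -, hZ₀⟩ := Finset.exists_subset_card_eq (s := (Finset.univ : Finset (Fin m)))
    (n := k) (by simpa using hkm)
  let O₀ : Fin m → Fin (k - 1) := fun _ => ⟨0, by omega⟩
  have hA₀ : SatOver (cliqueCNF m k (k - 1)) (cliqueVec Z₀) := cliqueCNF_satOver_cliqueVec Z₀ hZ₀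
  have hB₁ : SatOver (colourCNF m k (k - 1)) (colorVec O₀) := colourCNF_satOver_colorVec O₀
  obtain ⟨I, -, hIA, hIB, C, hC, hs, hCI⟩ :=
    cp_monotone_interpolation' (cliqueCNF m k (k - 1)) (colourCNF m k (k - 1))
      okA_of_mem_cliqueCNF okB_of_mem_colourCNF hA₀ hB₁ hπ
  exact ⟨I, fun S hS => hIA _ (cliqueCNF_satOver_cliqueVec S hS),
    fun O => hIB _ (colourCNF_satOver_colorVec O), C, hC, hs, hCI⟩

/-- **Exponential lower bound for cutting planes with small coefficients on clique–colouring**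
(Bonet–Pitassi–Raz 1997, §4): for all large `m`, with `k = ⌊√m⌋`, every `CP`
refutation `π` of `Clique_{m,k}(x,q) ∧ Colour_{m,k-1}(x,r)` satisfies
`2^{m^{1/8}} ≤ 8 |π| (cpNorm π + 3)³`. [cite: BonetPitassiRaz1997, §4] [cite: Pudlak1997, Thm. 3] -/
theorem cliqueColour_cuttingPlanes_lowerBound :
    ∀ᶠ m : ℕ in atTop,
      ∀ π : List (CPStep (CliqueColouring.Var m (Nat.sqrt m) (Nat.sqrt m - 1))),
        IsCPRefutation (cliqueColourCNF m (Nat.sqrt m) (Nat.sqrt m - 1)) π →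
          (2 : ℝ) ^ ((m : ℝ) ^ (1 / 8 : ℝ)) ≤ 8 * (π.length : ℝ) * ((cpNorm π : ℝ) + 3) ^ 3 := by
  filter_upwards [cliqueSqrt_monotone_lowerBound, eventually_ge_atTop 4] with m hm hm4 π hπ
  have hk : 2 ≤ Nat.sqrt m := by
    rw [Nat.le_sqrt]
    omega
  obtain ⟨f, hpos, hneg, C, hC, hs, hCf⟩ :=
    exists_monotone_circuit_of_cliqueColour_cpRefutation hk (Nat.sqrt_le_self m) hπ
  calc (2 : ℝ) ^ ((m : ℝ) ^ (1 / 8 : ℝ)) ≤ C.size := hm f hpos hneg C hC hCf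
    _ ≤ 8 * (π.length : ℝ) * ((cpNorm π : ℝ) + 3) ^ 3 := by exact_mod_cast hs

/-- **Norm versus coefficient size**: over a finite variable set, a derivation all of whose
integers (coefficients and constants) are bounded by `T` in absolute value has norm at most
`T (#variables + 1)` — so "small coefficients" (Bonet–Pitassi–Raz's `CP*`: coefficients
polynomially bounded) means polynomially bounded norm. [cite: BonetPitassiRaz1997, §4] -/
theorem cpNorm_le_of_coeff_le {ν : Type*} [Fintype ν] {π : List (CPStep ν)} {T : ℕ}
    (h : ∀ s ∈ π, s.line.const.natAbs ≤ T ∧ ∀ v, (s.line.coeff v).natAbs ≤ T) :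
    cpNorm π ≤ T * (Fintype.card ν + 1) := by
  classical
  unfold cpNorm
  induction π with
  | nil => simp
  | cons s π ih =>
    rw [List.map_cons, List.foldr_cons]
    refine max_le ?_ (ih fun s' hs' => h s' (List.mem_cons_of_mem _ hs'))
    obtain ⟨hc, hv⟩ := h s (List.mem_cons_self)
    unfold CPLine.norm Finsupp.sum
    have h1 : ∑ v ∈ s.line.coeff.support, (s.line.coeff v).natAbs ≤ Fintype.card ν * T :=
      calc ∑ v ∈ s.line.coeff.support, (s.line.coeff v).natAbs
          ≤ ∑ v ∈ s.line.coeff.support, T := Finset.sum_le_sum fun v _ => hv v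
        _ = s.line.coeff.support.card * T := by rw [Finset.sum_const, smul_eq_mul]
        _ ≤ Fintype.card ν * T := Nat.mul_le_mul_right _ (Finset.card_le_univ _)
    nlinarith

/-- **The `CP*` form** (Bonet–Pitassi–Raz 1997, §4): for all large `m`, every cutting planes
refutation of `Clique_{m,⌊√m⌋} ∧ Colour_{m,⌊√m⌋-1}` all of whose coefficients and constants are
bounded by `T` in absolute value satisfies `2^{m^{1/8}} ≤ 8 |π| (T (N + 1) + 3)³`, `N` the
number of variables (`= m(m-1)/2 + ⌊√m⌋ m + m (⌊√m⌋ - 1)`, polynomial in `m`).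
[cite: BonetPitassiRaz1997, §4] [cite: Pudlak1997, Thm. 3] -/
theorem cliqueColour_cuttingPlanes_lowerBound_of_coeff_le :
    ∀ᶠ m : ℕ in atTop, ∀ (T : ℕ)
      (π : List (CPStep (CliqueColouring.Var m (Nat.sqrt m) (Nat.sqrt m - 1)))),
        IsCPRefutation (cliqueColourCNF m (Nat.sqrt m) (Nat.sqrt m - 1)) π →
        (∀ s ∈ π, s.line.const.natAbs ≤ T ∧ ∀ v, (s.line.coeff v).natAbs ≤ T) →
          (2 : ℝ) ^ ((m : ℝ) ^ (1 / 8 : ℝ)) ≤ 8 * (π.length : ℝ) *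
            ((T : ℝ) * (Fintype.card (CliqueColouring.Var m (Nat.sqrt m) (Nat.sqrt m - 1)) + 1) + 3) ^ 3 := by
  filter_upwards [cliqueColour_cuttingPlanes_lowerBound] with m hm T π hπ hT
  refine (hm π hπ).trans ?_
  have h1 : (cpNorm π : ℝ) ≤ (T : ℝ) * (Fintype.card (CliqueColouring.Var m (Nat.sqrt m) (Nat.sqrt m - 1)) + 1) := by
    exact_mod_cast cpNorm_le_of_coeff_le hT
  gcongr

/-- **Cutting planes with polynomially bounded coefficients are not polynomially bounded, via
interpolation** (Bonet–Pitassi–Raz 1997): for all large `m` the clique–colouring CNF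
`Clique_{m,⌊√m⌋} ∧ Colour_{m,⌊√m⌋-1}` is unsatisfiable, has at most `5 m³` clauses, and every
cutting planes refutation `π` of it has `2^{m^{1/8}} / (8 (cpNorm π + 3)³) ≤ |π|` lines — at
least `2^{m^{1/8}} / (8 (m^c + 3)³)` for refutations of norm `≤ m^c`.
[cite: BonetPitassiRaz1997, §4] [cite: Pudlak1997, Thm. 3] -/
theorem cliqueColour_hard_for_cuttingPlanes :
    ∀ᶠ m : ℕ in atTop,
      ¬ (cliqueColourCNF m (Nat.sqrt m) (Nat.sqrt m - 1)).Satisfiable ∧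
      (cliqueColourCNF m (Nat.sqrt m) (Nat.sqrt m - 1)).length ≤ 5 * m ^ 3 ∧
      ∀ π : List (CPStep (CliqueColouring.Var m (Nat.sqrt m) (Nat.sqrt m - 1))),
        IsCPRefutation (cliqueColourCNF m (Nat.sqrt m) (Nat.sqrt m - 1)) π →
          (2 : ℝ) ^ ((m : ℝ) ^ (1 / 8 : ℝ)) / (8 * ((cpNorm π : ℝ) + 3) ^ 3) ≤ (π.length : ℝ) := by
  filter_upwards [cliqueColour_cuttingPlanes_lowerBound, eventually_ge_atTop 1] with m hm hm1
  refine ⟨cliqueColourCNF_not_satisfiable (Nat.sub_lt (Nat.sqrt_pos.2 (by omega)) one_pos),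
    length_cliqueColourCNF_sqrt_le m, fun π hπ => ?_⟩
  have h := hm π hπ
  have hpos : (0 : ℝ) < 8 * ((cpNorm π : ℝ) + 3) ^ 3 := by positivity
  rw [div_le_iff₀ hpos]
  linarith

end Literature.Computability.MetaComplexity
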